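import Mathlib
import Summits.AnomalousDissipation.AnomalousDissipation.Theses.DyadicWallCascade
import Summits.AnomalousDissipation.AnomalousDissipation.Theorems.DyadicWallCascadeDyadicRealisationGateReduction
import Summits.AnomalousDissipation.AnomalousDissipation.Theorems.DyadicWallCascadeDyadicRealisationFluxSign
import Summits.AnomalousDissipation.AnomalousDissipation.Theorems.DyadicWallCascadeDyadicRealisationZeroStress
import Summits.AnomalousDissipation.AnomalousDissipation.Theorems.DyadicWallCascadeDyadicRealisationLerayCapping
import HarnessLib

/-!
# Crux `DyadicWallCascade.DyadicRealisation` (stmt-AnomalousDissipation-17918) — skeleton of line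
# `Sketch` (card leray-capped-standing-cascade), reshaped by the line lead

The crux is, by `Iff.rfl`, `ViscousWallProfile → CoherentStates.SteadyZerothLaw`.  The line chooses
the force LAST: cap the mirror-doubled Euler hierarchy `(V, Q)` of the profile at the fixed collar
height `h = 1/8` by a smooth solenoidal lid `ū`, set `r := ū·∇ū + ∇(χQ)` (`≡ 0` on the wall collar
`|z| < 1/16`, where `V` solves Euler exactly) and `f := P r` (Leray projection).  Then the steady
budget `ν‖∇u‖² = ∫⟪f,u⟫ = ∫⟪r,u⟫` never looks at the wall layer (`stub_gateReduction`); the viscous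
profile `W` is used for two SIGNS only — `F < 0` (`stub_fluxSign`, localised energy identity +
blow-down scaling) and zero Reynolds stress `τ = ⟨V₃V_h⟩ = 0` (`stub_zeroStress`, localised horizontal
momentum identity + the same scaling); `stub_lerayCapping` is the construction; and the frontier is the
transferred crux `stub_testedRealisation` (loud bounded steady states for THIS capped pair, tested
against `r` off the wall).

Reshape w.r.t. the planner's sketch (Cruxes/DyadicRealisation/SketchIdeator1.lean): the sketch's
`TestedWeakRealisation` quantified over ALL pairs `(h, f, r)` and is junk-refutable modulo the
hierarchy (`f := 0`, `r := ∇ψ`); here C⁺ carries the full capping specification (in particular `ū`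
divergence free and exactly steady Euler with force `f` off the wall), the collar height is fixed
(`h = 1/8`), and `ProfileNormalisations` is split into `stub_fluxSign` ∧ `stub_zeroStress`.
All signatures are let-free (the clause blocks of the route decls with `H, e, pt, σ` substituted) and
fully qualified, so that stub files can copy them character for character.
Composition: `dyadicRealisation_of` below concludes the crux BY NAME from the five stubs.
STATUS: `stub_gateReduction` (p146963), `stub_fluxSign` (p152335), `stub_zeroStress` (p154515) and
`stub_lerayCapping` (p158513) have LANDED under Theorems/ and are imported; the only remaining `sorry` is the
frontier stub `stub_testedRealisation`.
-/

noncomputable section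

open MeasureTheory Filter Set
open scoped InnerProductSpace Topology BigOperators

-- the mandated namespace `Summit.<Summit>.<Problem>.Theorems` repeats `AnomalousDissipation`
set_option linter.dupNamespace false

namespace Summit.AnomalousDissipation.AnomalousDissipation.Theorems


/-- **stub_testedRealisation** (the transferred crux `C⁺`, tested weak realisation of the CAPPED pair;
the frontier stub — `SteadyWeakRealisation`-strength for one explicit force).  For a half-space
hierarchy with `F < 0` and zero Reynolds stress and for every capped pair `(f, r, ū, π)` as delivered by
`stub_lerayCapping`, there are viscosities `ν_j → 0⁺` and steady classical `NS_{ν_j}(f)` states with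
bounded energy whose tested work `∫⟪r, u_j⟫` stays above a positive floor (heuristically: `u_j ⇀ ū`
weakly in `L²` off the wall and `∫⟪r, ū⟫ = -2F > 0`). [open-problem] -/
theorem stub_testedRealisation : ∀ (V : EuclideanSpace ℝ (Fin 3) → EuclideanSpace ℝ (Fin 3)) (Q : EuclideanSpace ℝ (Fin 3) → ℝ) (C F : ℝ), ContDiffOn ℝ ((⊤ : ℕ∞) : WithTop ℕ∞) V {X : EuclideanSpace ℝ (Fin 3) | 0 < X 2} ∧ ContDiffOn ℝ ((⊤ : ℕ∞) : WithTop ℕ∞) Q {X : EuclideanSpace ℝ (Fin 3) | 0 < X 2} ∧ (∀ X : EuclideanSpace ℝ (Fin 3), 0 < X 2 → ‖V X‖ ≤ C ∧ |Q X| ≤ C) ∧ (∀ X : EuclideanSpace ℝ (Fin 3), 0 < X 2 → ∑ i : Fin 3, (fderiv ℝ V X (EuclideanSpace.single i (1 : ℝ))) i = 0) ∧ (∀ X : EuclideanSpace ℝ (Fin 3), 0 < X 2 → (fderiv ℝ V X) (V X) + gradient Q X = 0) ∧ (∀ X : EuclideanSpace ℝ (Fin 3), 0 < X 2 → V ((2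 : ℝ) • X) = V X ∧ Q ((2 : ℝ) • X) = Q X) ∧ (∀ X : EuclideanSpace ℝ (Fin 3), 1 ≤ X 2 → X 2 ≤ 2 → V (X + EuclideanSpace.single 0 (1 : ℝ)) = V X ∧ V (X + EuclideanSpace.single 1 (1 : ℝ)) = V X ∧ Q (X + EuclideanSpace.single 0 (1 : ℝ)) = Q X ∧ Q (X + EuclideanSpace.single 1 (1 : ℝ)) = Q X) ∧ (∫ q in Set.Icc (0 : ℝ) 1 ×ˢ Set.Icc (0 : ℝ) 1, (V !₂[q.1, q.2, (1 : ℝ)]) 2 = 0) ∧ F ≠ 0 ∧ (∫ q in Set.Icc (0 : ℝ) 1 ×ˢ Set.Icc (0 : ℝ) 1, (V !₂[q.1, q.2, (1 : ℝ)]) 2 * (‖V !₂[q.1, q.2, (1 : ℝ)]‖ ^ 2 / 2 + Q !₂[q.1, q.2, (1 : ℝ)]) = F) → F < 0 → (∫ q in Set.Icc (0 : ℝ) 1 ×ˢ Set.Icc (0 : ℝ) 1, (V !₂[q.1, q.2, (1 : ℝ)]) 2 * (V !₂[q.1, q.2, (1 : ℝ)]) 0 = 0) → (∫ q in Set.Icc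 (0 : ℝ) 1 ×ˢ Set.Icc (0 : ℝ) 1, (V !₂[q.1, q.2, (1 : ℝ)]) 2 * (V !₂[q.1, q.2, (1 : ℝ)]) 1 = 0) → ∀ (f r ub : UnitAddTorus (Fin 3) → EuclideanSpace ℝ (Fin 3)) (π : EuclideanSpace ℝ (Fin 3) → ℝ) (C' : ℝ), Literature.Analysis.FunctionSpaces.Torus.IsSmooth f ∧ Literature.Analysis.FunctionSpaces.Torus.IsDivFree f ∧ Literature.Analysis.FunctionSpaces.Torus.HasZeroMean f ∧ Literature.Analysis.FunctionSpaces.Torus.IsSmooth r ∧ (∀ Y : EuclideanSpace ℝ (Fin 3), |Y 2| < 1 / 16 → Literature.Analysis.FunctionSpaces.Torus.lift r Y = 0) ∧ (∀ w : UnitAddTorus (Fin 3) → EuclideanSpace ℝ (Fin 3), Literature.Analysis.FunctionSpaces.Torus.IsSmooth w → Literature.Analysis.FunctionSpaces.Torus.IsDivFree w → ∫ x, ⟪f x, w x⟫_ℝ = ∫ x, ⟪r x, w x⟫_ℝ) ∧ (∀ x, ‖ub x‖ ≤ C') ∧ (∀ Y : EuclideanSpace ℝ (Fin 3), 0 < Y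 2 → Y 2 < 1 / 16 → Literature.Analysis.FunctionSpaces.Torus.lift ub Y = V Y) ∧ (∀ Y : EuclideanSpace ℝ (Fin 3), -(1 / 16) < Y 2 → Y 2 < 0 → Literature.Analysis.FunctionSpaces.Torus.lift ub Y = V (Y - (2 * Y 2) • EuclideanSpace.single 2 (1 : ℝ)) - (2 * (V (Y - (2 * Y 2) • EuclideanSpace.single 2 (1 : ℝ))) 2) • EuclideanSpace.single 2 (1 : ℝ)) ∧ ContDiffOn ℝ ((⊤ : ℕ∞) : WithTop ℕ∞) (Literature.Analysis.FunctionSpaces.Torus.lift ub) {Y : EuclideanSpace ℝ (Fin 3) | 0 < Y 2 ∧ Y 2 < 1} ∧ ContDiffOn ℝ ((⊤ : ℕ∞) : WithTop ℕ∞) π {Y : EuclideanSpace ℝ (Fin 3) | 0 < Y 2 ∧ Y 2 < 1} ∧ (∀ Y : EuclideanSpace ℝ (Fin 3), 0 < Y 2 → Y 2 < 1 → ∑ i : Fin 3, (fderiv ℝ (Literature.Analysis.FunctionSpaces.Torus.lift ub) Y (EuclideanSpace.single i (1 : ℝ))) i = 0) ∧ (∀ Y : EuclideanSpace ℝ (Fin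 3), 0 < Y 2 → Y 2 < 1 → (fderiv ℝ (Literature.Analysis.FunctionSpaces.Torus.lift ub) Y) (Literature.Analysis.FunctionSpaces.Torus.lift ub Y) + gradient π Y = Literature.Analysis.FunctionSpaces.Torus.lift f Y) ∧ ∫ x, ⟪r x, ub x⟫_ℝ = -2 * F → ∃ (ν : ℕ → ℝ) (u : ℕ → UnitAddTorus (Fin 3) → EuclideanSpace ℝ (Fin 3)) (p : ℕ → UnitAddTorus (Fin 3) → ℝ), (∀ j, 0 < ν j) ∧ Filter.Tendsto ν Filter.atTop (nhds 0) ∧ (∀ j, Literature.Analysis.FunctionSpaces.Torus.IsClassicalNSSolutionOn Set.univ (ν j) (fun _ => f) (fun _ => u j) (fun _ => p j)) ∧ (∃ E : ℝ, ∀ j, ∫ x, ‖u j x‖ ^ 2 ≤ E) ∧ ∃ ε : ℝ, 0 < ε ∧ ∀ j, ε ≤ ∫ x, ⟪r x, u j x⟫_ℝ := by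
  sorry

/-- **Composition** (pure logic): the five stubs conclude the crux `DyadicWallCascade.DyadicRealisation`
BY NAME.  From the profile block: the hierarchy clauses, `F < 0` (`stub_fluxSign`) and `τ = 0`
(`stub_zeroStress`); `stub_lerayCapping` delivers the capped pair, `stub_testedRealisation` the loud
states, `stub_gateReduction` the steady zeroth law. -/
theorem dyadicRealisation_of :
    Summit.AnomalousDissipation.AnomalousDissipation.Theses.DyadicWallCascade.DyadicRealisation := by
  intro hA
  obtain ⟨W, P, V, Q, C, F, C', hblk⟩ := hA
  have hF : F < 0 := stub_fluxSign W P V Q C F C' hblk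
  have hτ := stub_zeroStress W P V Q C F C' hblk
  obtain ⟨hV, -⟩ := hblk
  obtain ⟨f, r, ub, π, C'', hcap⟩ := stub_lerayCapping V Q C F hV hτ.1 hτ.2
  obtain ⟨ν, u, p, hν, hν0, hsol, hE, hε⟩ :=
    stub_testedRealisation V Q C F hV hF hτ.1 hτ.2 f r ub π C'' hcap
  obtain ⟨hfs, hfd, hfm, -, -, hP, -⟩ := hcap
  exact stub_gateReduction f r hfs hfd hfm hP ν u p hν hν0 hsol hE hε

end Summit.AnomalousDissipation.AnomalousDissipation.Theorems

end
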